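import Summits.ABC.IUTFork.Joshi.ArithmeticoidCollation

/-!
# Joshi, *Arithmetic Teichmüller Spaces II½* (arXiv:2305.10398v12) Prop. 4.2.2 — the decorated Galois group `𝔊_L = ∏_v G_v`
# is `G_L`-amphoric — and its use as the reduction step of Prop. 7.4.1 (typed; the use DERIVED)

Record file of the abc-iut cell, branch E «type Joshi's construction, test vs S» (rung LADDER-ABC:A2.E; seat abc-iut-E-t38;
node J2h:Prop4.2.2 of plan/E/JOSHI-DAG.tsv, brought into R11-scope by the dependency edge J2h:Prop7.4.1 → J2h:Prop4.2.2:
the PROOF of Prop. 7.4.1, p.48 l.43–44, «The isomorphism class of G_L determines, by Corollary 4.6.1, the isomorphism class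
of 𝔊_L and the isomorphism class of each of its factors G_{L_v}, so one reduces to the local case», invokes BY CONTENT
Prop. 4.2.2 — Cor. 4.6.1, p.27 l.26–37, is about the actions on `B_L`; a numbering slip recorded here, not adjudicated).
SOURCE: K. Joshi, *Construction of Arithmetic Teichmüller Spaces II½: Deformations of Number Fields*, arXiv:2305.10398**v12**
(UNREFEREED, «Preliminary version for comments»; bib `Joshi2023ATS2half`); locators «p.N l.M» = line M of page file `pNNNN.txt`
of `HOME/plan/repair/lit/renders/Joshi-arxiv-2305.10398-ATS2half/`. Carriers and conventions of
`Joshi/ArithmeticoidCohomology.lean` / `Joshi/ArithmeticoidCollation.lean` (seat T-38) are in force: places `V`, local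
parameter spaces `Pt v`, arithmeticoids `y : ∀ v, Pt v`, local Galois groups `G v y_v = G_{L_v;K_{y_v}}` (topological
groups); NEW here: the absolute Galois group `GL y` «of L provided by arith(L)_y» (§7.2 p.46 l.33–35; §4.2 p.21 l.46–49) as a
further parameter carrier. **No side is taken** on [IUTchIII] Cor. 3.12, on Joshi's claims, or on Mochizuki's report on
them; typed ≠ proved; print's assertions are `@[claim "Joshi2023ATS2half" "disputed"] def … : Prop`, never axioms /
instances / Literature facts; what FOLLOWS is proved. The §4.2 OBJECTS (`𝒴_L`, the actions, (4.2.1) as the acting group) are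
slot T-37's `Joshi/Arithmeticoids.lean` (`ATS2h.DeformationDatum.GalProd`); this file restates (4.2.1) only point-dependently
(`decoratedGalois G y = ∀ v, G v (y v)`, needed because §7's Galois groups depend on the arithmeticoid) and types the one
§4.2 STATEMENT T-37's list does not carry. READING FLAG (E-ref): print's characterization of the factors is «modulo the
action of G_L by conjugation» ([Hoshi 2015, Prop. 3.5]) — i.e. the factors are recovered as a set of conjugacy classes of
closed subgroups; the IDENTITY indexing of places used below («each of its factors G_{L_v}», two arithmeticoids of the SAME
`L`) is the form Prop. 7.4.1's proof consumes. Standard axioms only; sorry-free. [claim: Joshi2023ATS2half, status: disputed]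
-/

set_option autoImplicit false

noncomputable section

open Set

namespace Summit.ABC.IUTFork.Joshi.ATS2half

universe u

variable {V : Type u} {Pt : V → Type u} (G : (v : V) → Pt v → Type u) [∀ v y, Group (G v y)]
  [∀ v y, TopologicalSpace (G v y)] (GL : (∀ v, Pt v) → Type u) [∀ y, Group (GL y)] [∀ y, TopologicalSpace (GL y)]

/-- **(4.2.1), point-dependently** (p.21 l.49–52: «Let 𝔊_L = ∏_{v∈V_L} G_v be the product of all the local galois groups
equipped with the product topology, making 𝔊_L into a topological group»): the decorated Galois group of the arithmeticoid
`y`, each factor computed in `K_{y_v}` (§7.2 p.46 l.36–38). Slot T-37's `ATS2h.DeformationDatum.GalProd` is the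
point-independent version; restated here only because §7 needs the dependence on `y`. [claim: Joshi2023ATS2half,
status: disputed] -/
abbrev decoratedGalois (y : ∀ v, Pt v) : Type u := ∀ v, G v (y v)

/-- **The standing input of §7.4** (p.48 l.21–24 «Now suppose arith(L)_{y₁}, arith(L)_{y₂} are two arithmeticoids of L»;
§7.2 p.46 l.33–35 «let G_L = Gal(L̄/L) be the absolute Galois group of L provided by arith(L)_y»; §4.2 p.21 l.46–48): the
absolute Galois groups of `L` provided by any two arithmeticoids are isomorphic topological groups (both are `Gal(L̄/L)`
for algebraic closures of the same field). HYPOTHESIS (classical; tagged because print uses it without statement).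
[claim: Joshi2023ATS2half, status: disputed] -/
@[claim "Joshi2023ATS2half" "disputed"]
def GlobalGaloisIsomorphic : Prop :=
  ∀ y₁ y₂ : ∀ v, Pt v, Nonempty (GL y₁ ≃ₜ* GL y₂)

/-- **Prop. 4.2.2** (p.21 l.56–63): «The topological group 𝔊_L is G_L-amphoric i.e. the isomorphism class of the
topological group 𝔊_L is determined by the isomorphism class of G_L. Proof. This is immediate from the fact that the set of
toplogical groups {G_{L_v} : v ∈ V_L} is characterized as the set of maximal closed subgroups of G_L which are of
"Mixed-Characteristic Local Field Type" modulo the action of G_L by conjugation (see [Hoshi, 2015, Proposition 3.5]).»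
(Joshi: «while not needed in this paper, is a classical result», p.21 l.53–55 — yet it is the content of the reduction step
of Prop. 7.4.1, p.48 l.43–44, cited there as «Corollary 4.6.1».) Typed in the form that proof consumes: an isomorphism of the
absolute Galois groups provided by two arithmeticoids yields an isomorphism of the decorated groups AND of each factor
(identity indexing of places — READING FLAG in the module docstring). HYPOTHESIS (claim). [claim: Joshi2023ATS2half,
status: disputed] -/
@[claim "Joshi2023ATS2half" "disputed"]
def Prop422 : Prop :=
  ∀ y₁ y₂ : ∀ v, Pt v, Nonempty (GL y₁ ≃ₜ* GL y₂) →
    Nonempty (decoratedGalois G y₁ ≃ₜ* decoratedGalois G y₂) ∧ ∀ v, Nonempty (G v (y₁ v) ≃ₜ* G v (y₂ v))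

variable {G GL}

/-- The decorated-group half of Prop. 4.2.2 already follows from its factorwise half (product of isomorphisms of topological
groups; elementary). [folklore] -/
theorem decoratedGalois_iso_of_factors {y₁ y₂ : ∀ v, Pt v} (h : ∀ v, Nonempty (G v (y₁ v) ≃ₜ* G v (y₂ v))) :
    Nonempty (decoratedGalois G y₁ ≃ₜ* decoratedGalois G y₂) := by
  have e : ∀ v, G v (y₁ v) ≃ₜ* G v (y₂ v) := fun v => Classical.choice (h v)
  refine ⟨{ MulEquiv.piCongrRight (fun v => (e v).toMulEquiv) with
    continuous_toFun := ?_, continuous_invFun := ?_ }⟩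
  · exact continuous_pi fun v => (e v).continuous_toFun.comp (continuous_apply v)
  · exact continuous_pi fun v => (e v).continuous_invFun.comp (continuous_apply v)

/-- **Prop. 7.4.1's reduction step DERIVED from Prop. 4.2.2** (p.48 l.43–44): given the absolute Galois groups of any two
arithmeticoids are isomorphic (`GlobalGaloisIsomorphic`) and Prop. 4.2.2, the local Galois groups at every place and every
pair of points are isomorphic topological groups — `LocalGaloisIsomorphic G`, the hypothesis under which
`Joshi/ArithmeticoidCollation.lean` derives Prop. 7.4.1 (`prop741_of`) and inhabits reading N (`providedIsos_nonempty`).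
(A pair of points `a, b ∈ |Y_v|` is completed to two arithmeticoids agreeing with a fixed one off `v`.)
[claim: Joshi2023ATS2half, status: disputed] -/
theorem localGaloisIsomorphic_of_prop422 [DecidableEq V] (y₀ : ∀ v, Pt v) (hGL : GlobalGaloisIsomorphic GL)
    (h422 : Prop422 G GL) : LocalGaloisIsomorphic G := by
  intro v a b
  have h := (h422 (Function.update y₀ v a) (Function.update y₀ v b) (hGL _ _)).2 v
  have ha : Function.update y₀ v a v = a := Function.update_self v a y₀
  have hb : Function.update y₀ v b v = b := Function.update_self v b y₀
  rw [ha, hb] at h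
  exact h

/-- Hence, with [J-I] Thm. 8.4.1 (2) on the Fontaine subspaces (`CohPreservesFontaine`), **Prop. 7.4.1 follows from
Prop. 4.2.2** along the printed proof (p.48 l.43–46) — the provenance chain of reading N made explicit.
[claim: Joshi2023ATS2half, status: disputed] -/
theorem prop741_of_prop422 [DecidableEq V] {H : ℕ → (v : V) → Pt v → Type u} [∀ i v y, CommGroup (H i v y)]
    [∀ i v y, TopologicalSpace (H i v y)] {IsArc : Set V} (𝔠 : CohomologyDatum H IsArc G)
    {Hf : ∀ i v (y : Pt v), Subgroup (H i v y)} (hGL : GlobalGaloisIsomorphic GL) (h422 : Prop422 G GL)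
    (hf : 𝔠.CohPreservesFontaine Hf) : Prop741 H Hf :=
  prop741_of 𝔠 (localGaloisIsomorphic_of_prop422 𝔠.std hGL h422) hf

/-- The decorated-group clause of Prop. 4.2.2, extracted. (The converse direction — from an isomorphism of the decorated
products to factorwise isomorphisms — is NOT claimed anywhere here: a product isomorphism need not respect the factors, places
with isomorphic local Galois groups may be permuted; this is why `Prop422` carries its factorwise clause explicitly.)
[claim: Joshi2023ATS2half, status: disputed] -/
theorem decoratedGalois_iso_of_prop422 (h422 : Prop422 G GL) {y₁ y₂ : ∀ v, Pt v} (h : Nonempty (GL y₁ ≃ₜ* GL y₂)) :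
    Nonempty (decoratedGalois G y₁ ≃ₜ* decoratedGalois G y₂) :=
  (h422 y₁ y₂ h).1

end Summit.ABC.IUTFork.Joshi.ATS2half

end
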